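/-
Copyright (c) 2026 the pub-hodgecm-mathlib formalisation cell (harness21).  Prover seat hodgecm-mathlib-F0P3a-p03 (g21), 2026-09-02 (LH7 leaf ED. 3 road,
print organ O8a `PKsaU2Shape`, step (3): the three topological-group SOCKETS of the Kneser saturation in normal form).
-/
import Literature.NumberTheory.Automorphic.DiscreteAutomorphicRepConjStableFixed
import Literature.NumberTheory.Automorphic.UnitaryGroupAdelicProductHaar
import Literature.NumberTheory.Automorphic.UnitaryGroupAdelicDet
import Literature.NumberTheory.Automorphic.UnitaryGroupRankTwoStrongApproximation
import Literature.NumberTheory.Automorphic.AutomorphicKneserCharacter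
import HarnessLib

/-!
# The sockets of the Kneser step for `U(J)`: `SU(J)(𝔸_F)` closed normal, `ι_v SU(J)(F_v)` closed and conjugation-stable,
# `toAdelic SU(J)(F) ⊆ A_G·G(F)`, strong approximation in socket spelling — and the plugged head (rank 2)

Topic `NumberTheory/Automorphic`; THEOREMS ONLY (no definition, no instance, no named fact, no notation, no `sorry`).

★ `AutomorphicKneserCharacter` (`UnitaryGroup.exists_eq_ofChar_of_subset_closure_of_commutator_mem`, over ★
`AutomorphicQuotientSaturationNormal`) asks its `U(J)` consumer for: a CLOSED NORMAL `N₀ ≤ U(J)(𝔸_F)` containing the commutators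
`g⁻¹ b⁻¹ g b` (`b` finite-adelic), a set `D ⊆ A_G · U(J)(F)`, a set `S₁` fixing every vector of `P`, and the density
`N₀ ⊆ closure ⟨D ∪ S₁⟩`.  This file supplies them in the tree's letters (`adelic`, `adelicDet`, `inclPlaceAdelic`, `toAdelic`,
`AdelicGroupData.quotientSubgroup`) and plugs them (rank `2`, `J ≃ antidiag(1,1)`):

* §1 `N₀ = SU(J)(𝔸_F) = ker (adelicDet)`: `continuous_det_coe_adelic`, `isClosed_setOf_det_eq_one`, `mem_ker_adelicDet_iff`,
  `coe_ker_adelicDet`, `isClosed_ker_adelicDet`, `inv_mul_inv_mul_mul_mem_ker_adelicDet` (commutators), and the `det J ≠ 0`-free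
  packaging `exists_subgroup_normal_isClosed_coe_eq_setOf_det_eq_one`.
* §2 `S₁ = ι_v(SU(J)(F_v))`: `isClosedEmbedding_inclPlace`, `isClosedEmbedding_inclPlaceAdelic` (continuous retractions `evalPlace v`,
  `finPart`), `isClosed_setOf_forall_det_eq_one`, `isClosed_image_inclPlaceAdelic_det_eq_one`, `conj_mem_image_inclPlaceAdelic_det_eq_one`
  (adelic form of ★ `conj_mem_image_inclPlace_det_eq_one`) — not needed by the ★ consumer (it takes `S₁` as a bare set), recorded as API.
* §3 `D = toAdelic(SU(J)(F))`: `toAdelic_image_subset_quotientSubgroup`.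
* §4 `S₁` fixes `P`: `forall_mem_image_inclPlaceAdelic_toContRep_apply_eq_self` (★ `DiscreteAutomorphicRepConjStableFixed` in socket spelling).
* §5 rank `2`: the density socket `coe_subset_closure_of_coe_eq` (★ `mem_topologicalClosure_of_det_eq_one` = strong approximation for
  `SU(antidiag(1,1))` with one finite place free, read through `Subgroup.topologicalClosure_coe`) and its CM dress.
* §6 PLUGGED (rank `2`, generic `F E c`, `J = antidiag(1,1)` up to the letter `hJ2`): **`toContRep_apply_eq_self_of_det_eq_one`** — if
  `SU(J)(F_{v₁})` acts trivially on a finite component `σ ↪ P.finRep`, then every `s ∈ U(J)(𝔸_F)` with `det s = 1` fixes every vector of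
  `P` — and **`exists_eq_ofChar_of_forall_det_eq_one_apply_eq_self`** — under weak approximation at `∞`, `P = ofChar ψ μ` for an
  automorphic character `ψ`.

CONSUMER (cell `hodgecm-mathlib`, crux H413 = stmt-HodgeConjecture-24833, O8a `PKsaU2Shape` assembly (6), `Theorems/F0P3cPKtupleSaU2.lean`):
`exists_eq_ofChar_of_forall_det_eq_one_apply_eq_self` at `(L⁺, L, conj, Φ₂)` with `hWA` := the tree's weak approximation for `U(Φ₂)`,
`hfix` := «a character of `U(Φ₂)(L⁺_{v₁})` kills `SU`» ∘ ★ `UnitaryGroupRankTwoLocalCharacterIsotypy`; then ★ `UnitaryGroupDetCharacterSection`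
(`ψ = cmDetChar θ`) and ★ `F0P3cPKtupleSaU2LocalClasses`.  HONEST LABEL: plumbing over ★ bricks; HC_CM is proved only modulo the printed
citations of that programme until its rung 0 closes.

References: [PlatonovRapinchuk1994] V. Platonov, A. Rapinchuk, *Algebraic groups and number theory* (1994), §5.1 (adelic topology, place
inclusions), §7.4 Thm. 7.12 and proof of Prop. 7.13 (strong approximation, Kneser's argument); [Kneser1966] M. Kneser, *Strong approximation*,
Proc. Sympos. Pure Math. IX; [BorelJacquet1979] A. Borel, H. Jacquet, *Automorphic forms and automorphic representations*, §4.1, §4.6.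
-/

set_option autoImplicit false

noncomputable section

open NumberField IsDedekindDomain Topology Set

namespace Literature.NumberTheory.Automorphic

namespace UnitaryGroup

variable (F E : Type) [Field F] [NumberField F] [Field E] [NumberField E] [Algebra F E]
  (c : E ≃ₐ[F] E) (N : ℕ) (J : Matrix (Fin N) (Fin N) E)

/-! ## §1 `SU(J)(𝔸_F)`: closed and normal -/

omit [NumberField F] in
/-- `s ↦ det s` is continuous on `U(J)(𝔸_F)`. [cite: PlatonovRapinchuk1994, §5.1] -/
theorem continuous_det_coe_adelic :
    Continuous fun s : ↥(adelic F E c N J) =>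
      ((s : GL (Fin N) (AdeleRing (𝓞 E) E)) : Matrix (Fin N) (Fin N) (AdeleRing (𝓞 E) E)).det :=
  (Units.continuous_val.comp continuous_subtype_val).matrix_det

omit [NumberField F] in
/-- **`SU(J)(𝔸_F) = {s ∈ U(J)(𝔸_F) | det s = 1}` is closed.** [cite: PlatonovRapinchuk1994, §5.1] -/
theorem isClosed_setOf_det_eq_one :
    IsClosed {s : ↥(adelic F E c N J) |
      ((s : GL (Fin N) (AdeleRing (𝓞 E) E)) : Matrix (Fin N) (Fin N) (AdeleRing (𝓞 E) E)).det = 1} := by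
  haveI : T2Space (FiniteAdeleRing (𝓞 E) E) := inferInstanceAs <| T2Space
    (RestrictedProduct (fun v : HeightOneSpectrum (𝓞 E) => v.adicCompletion E)
      (fun v => (v.adicCompletionIntegers E : Set (v.adicCompletion E))) Filter.cofinite)
  haveI : T2Space (AdeleRing (𝓞 E) E) := inferInstanceAs <| T2Space (InfiniteAdeleRing E × FiniteAdeleRing (𝓞 E) E)
  exact isClosed_eq (continuous_det_coe_adelic F E c N J) continuous_const

/-- **`SU(J)(𝔸_F)` as a closed normal subgroup of `U(J)(𝔸_F)`** (the kernel of `det`), packaged existentially: there is a normal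
subgroup `N ≤ U(J)(𝔸_F)`, closed, whose carrier is exactly `{s | det s = 1}`. [cite: PlatonovRapinchuk1994, §5.1] -/
theorem exists_subgroup_normal_isClosed_coe_eq_setOf_det_eq_one :
    ∃ N' : Subgroup (adelicGroupData F E c N J).Adelic, N'.Normal ∧ IsClosed (N' : Set (adelicGroupData F E c N J).Adelic) ∧
      (N' : Set (adelicGroupData F E c N J).Adelic) = {s : ↥(adelic F E c N J) |
        ((s : GL (Fin N) (AdeleRing (𝓞 E) E)) : Matrix (Fin N) (Fin N) (AdeleRing (𝓞 E) E)).det = 1} := by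
  have hcoe : (((Matrix.GeneralLinearGroup.det.comp (adelic F E c N J).subtype).ker : Subgroup ↥(adelic F E c N J)) :
      Set ↥(adelic F E c N J)) = {s : ↥(adelic F E c N J) |
        ((s : GL (Fin N) (AdeleRing (𝓞 E) E)) : Matrix (Fin N) (Fin N) (AdeleRing (𝓞 E) E)).det = 1} := by
    ext s
    rw [SetLike.mem_coe, MonoidHom.mem_ker, MonoidHom.comp_apply, Subgroup.subtype_apply, mem_setOf_eq, ← Units.val_eq_one,
      Matrix.GeneralLinearGroup.val_det_apply]
  exact ⟨(Matrix.GeneralLinearGroup.det.comp (adelic F E c N J).subtype).ker, MonoidHom.normal_ker _,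
    hcoe ▸ isClosed_setOf_det_eq_one F E c N J, hcoe⟩

omit [NumberField F] in
/-- Membership in `ker (adelicDet)`: `det s = 1` as an adele. [cite: PlatonovRapinchuk1994, §5.1] -/
theorem mem_ker_adelicDet_iff (hJ : J.det ≠ 0) (s : ↥(adelic F E c N J)) :
    s ∈ (adelicDet F E c N J hJ).ker ↔
      ((s : GL (Fin N) (AdeleRing (𝓞 E) E)) : Matrix (Fin N) (Fin N) (AdeleRing (𝓞 E) E)).det = 1 := by
  rw [MonoidHom.mem_ker, Subtype.ext_iff, Units.ext_iff]
  exact Iff.rfl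

omit [NumberField F] in
/-- **`SU(J)(𝔸_F) = ker (adelicDet)` has carrier `{s | det s = 1}`.** [cite: PlatonovRapinchuk1994, §5.1] -/
theorem coe_ker_adelicDet (hJ : J.det ≠ 0) :
    ((adelicDet F E c N J hJ).ker : Set ↥(adelic F E c N J)) =
      {s : ↥(adelic F E c N J) | ((s : GL (Fin N) (AdeleRing (𝓞 E) E)) : Matrix (Fin N) (Fin N) (AdeleRing (𝓞 E) E)).det = 1} :=
  Set.ext fun s => mem_ker_adelicDet_iff F E c N J hJ s

omit [NumberField F] in
/-- **`ker (adelicDet)` is closed in `U(J)(𝔸_F)`.** [cite: PlatonovRapinchuk1994, §5.1] -/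
theorem isClosed_ker_adelicDet (hJ : J.det ≠ 0) :
    IsClosed ((adelicDet F E c N J hJ).ker : Set ↥(adelic F E c N J)) := by
  rw [coe_ker_adelicDet]
  exact isClosed_setOf_det_eq_one F E c N J

omit [NumberField F] in
/-- **Commutators have determinant one**: `g⁻¹ x⁻¹ g x ∈ ker (adelicDet)` (the target `U(1)(𝔸_F)` is commutative). [cite: PlatonovRapinchuk1994, §5.1] -/
theorem inv_mul_inv_mul_mul_mem_ker_adelicDet (hJ : J.det ≠ 0) (g x : ↥(adelic F E c N J)) :
    g⁻¹ * x⁻¹ * g * x ∈ (adelicDet F E c N J hJ).ker := by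
  rw [MonoidHom.mem_ker, map_mul, map_mul, map_mul, map_inv, map_inv, mul_right_comm (adelicDet F E c N J hJ g)⁻¹, inv_mul_cancel,
    one_mul, inv_mul_cancel]

omit [NumberField F] in
/-- **Commutators have determinant one**, `det J ≠ 0`-free matrix spelling: `det (g⁻¹ x⁻¹ g x) = 1`. [cite: PlatonovRapinchuk1994, §5.1] -/
theorem det_coe_inv_mul_inv_mul_mul (g x : ↥(adelic F E c N J)) :
    (((g⁻¹ * x⁻¹ * g * x : ↥(adelic F E c N J)) : GL (Fin N) (AdeleRing (𝓞 E) E)) : Matrix (Fin N) (Fin N) (AdeleRing (𝓞 E) E)).det = 1 := by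
  have h : Matrix.GeneralLinearGroup.det ((g⁻¹ * x⁻¹ * g * x : ↥(adelic F E c N J)) : GL (Fin N) (AdeleRing (𝓞 E) E)) = 1 := by
    rw [Subgroup.coe_mul, Subgroup.coe_mul, Subgroup.coe_mul, Subgroup.coe_inv, Subgroup.coe_inv, map_mul, map_mul, map_mul, map_inv,
      map_inv, mul_right_comm (Matrix.GeneralLinearGroup.det (g : GL (Fin N) (AdeleRing (𝓞 E) E)))⁻¹, inv_mul_cancel, one_mul, inv_mul_cancel]
  rw [← Matrix.GeneralLinearGroup.val_det_apply, h, Units.val_one]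

/-! ## §2 `ι_v(SU(J)(F_v))`: closed and normal -/

/-- **`inclPlace v : U(J)(F_v) → U(J)(𝔸_{F,f})` is a closed embedding** (continuous, continuous retraction `evalPlace v`, Hausdorff
target). [cite: PlatonovRapinchuk1994, §5.1] -/
theorem isClosedEmbedding_inclPlace (v : HeightOneSpectrum (𝓞 F)) : IsClosedEmbedding (inclPlace F E c N J v) := by
  haveI : T2Space (finAdelic F E c N J) := t2Space_finAdelic F E c N J
  exact Function.LeftInverse.isClosedEmbedding (evalPlace_inclPlace F E c N J v) (continuous_evalPlace F E c N J v)
    (continuous_inclPlace F E c N J v)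

/-- **`inclPlaceAdelic v : U(J)(F_v) → U(J)(𝔸_F)` is a closed embedding.** [cite: PlatonovRapinchuk1994, §5.1] -/
theorem isClosedEmbedding_inclPlaceAdelic (v : HeightOneSpectrum (𝓞 F)) : IsClosedEmbedding (inclPlaceAdelic F E c N J v) := by
  have h : (inclPlaceAdelic F E c N J v : localPi E c N J v → (adelicGroupData F E c N J).Adelic) =
      finAdelicToAdelic F E c N J ∘ inclPlace F E c N J v := by
    funext u; exact inclPlaceAdelic_apply F E c N J v u
  rw [h]
  exact (isClosedEmbedding_finAdelicToAdelic F E c N J).comp (isClosedEmbedding_inclPlace F E c N J v)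

/-- `u ↦ det u_w` is continuous on `U(J)(F_v) ≤ Π_{w ∣ v} GL_N(E_w)`. [cite: PlatonovRapinchuk1994, §5.1] -/
theorem continuous_det_apply_localPi (v : HeightOneSpectrum (𝓞 F)) (w : PlacesOver E v) :
    Continuous fun u : ↥(localPi E c N J v) =>
      (((u : LocalGLPi E N v) w : GL (Fin N) (w.1.adicCompletion E)) : Matrix (Fin N) (Fin N) (w.1.adicCompletion E)).det :=
  (Units.continuous_val.comp ((continuous_apply w).comp continuous_subtype_val)).matrix_det

/-- **`SU(J)(F_v) = {u | det u_w = 1 for all w ∣ v}` is closed in `U(J)(F_v)`.** [cite: PlatonovRapinchuk1994, §5.1] -/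
theorem isClosed_setOf_forall_det_eq_one (v : HeightOneSpectrum (𝓞 F)) :
    IsClosed {u : ↥(localPi E c N J v) | ∀ w : PlacesOver E v,
      (((u : LocalGLPi E N v) w : GL (Fin N) (w.1.adicCompletion E)) : Matrix (Fin N) (Fin N) (w.1.adicCompletion E)).det = 1} := by
  rw [show {u : ↥(localPi E c N J v) | ∀ w : PlacesOver E v,
      (((u : LocalGLPi E N v) w : GL (Fin N) (w.1.adicCompletion E)) : Matrix (Fin N) (Fin N) (w.1.adicCompletion E)).det = 1} =
      ⋂ w : PlacesOver E v, {u : ↥(localPi E c N J v) |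
        (((u : LocalGLPi E N v) w : GL (Fin N) (w.1.adicCompletion E)) : Matrix (Fin N) (Fin N) (w.1.adicCompletion E)).det = 1} by
    ext u; simp only [mem_setOf_eq, mem_iInter]]
  exact isClosed_iInter fun w => isClosed_eq (continuous_det_apply_localPi F E c N J v w) continuous_const

/-- **`ι_v(SU(J)(F_v))` is closed in `U(J)(𝔸_F)`.** [cite: PlatonovRapinchuk1994, §5.1] -/
theorem isClosed_image_inclPlaceAdelic_det_eq_one (v : HeightOneSpectrum (𝓞 F)) :
    IsClosed (inclPlaceAdelic F E c N J v '' {u : ↥(localPi E c N J v) | ∀ w : PlacesOver E v,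
      (((u : LocalGLPi E N v) w : GL (Fin N) (w.1.adicCompletion E)) : Matrix (Fin N) (Fin N) (w.1.adicCompletion E)).det = 1}) :=
  (isClosedEmbedding_inclPlaceAdelic F E c N J v).isClosedMap _ (isClosed_setOf_forall_det_eq_one F E c N J v)

/-- **`ι_v(SU(J)(F_v))` is stable under conjugation by `U(J)(𝔸_F)`** (the conjugating element acts through its `v`-component, ★
`conj_mem_image_inclPlace_det_eq_one`, and the archimedean part commutes with `U(J)(𝔸_{F,f})`). [cite: PlatonovRapinchuk1994, §5.1] -/
theorem conj_mem_image_inclPlaceAdelic_det_eq_one (v : HeightOneSpectrum (𝓞 F)) (a : (adelicGroupData F E c N J).Adelic)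
    {x : (adelicGroupData F E c N J).Adelic}
    (hx : x ∈ inclPlaceAdelic F E c N J v '' {u : ↥(localPi E c N J v) | ∀ w : PlacesOver E v,
      (((u : LocalGLPi E N v) w : GL (Fin N) (w.1.adicCompletion E)) : Matrix (Fin N) (Fin N) (w.1.adicCompletion E)).det = 1}) :
    a * x * a⁻¹ ∈ inclPlaceAdelic F E c N J v '' {u : ↥(localPi E c N J v) | ∀ w : PlacesOver E v,
      (((u : LocalGLPi E N v) w : GL (Fin N) (w.1.adicCompletion E)) : Matrix (Fin N) (Fin N) (w.1.adicCompletion E)).det = 1} := by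
  have himg : inclPlaceAdelic F E c N J v '' {u : ↥(localPi E c N J v) | ∀ w : PlacesOver E v,
      (((u : LocalGLPi E N v) w : GL (Fin N) (w.1.adicCompletion E)) : Matrix (Fin N) (Fin N) (w.1.adicCompletion E)).det = 1} =
      finAdelicToAdelic F E c N J '' (inclPlace F E c N J v '' {u : ↥(localPi E c N J v) | ∀ w : PlacesOver E v,
        (((u : LocalGLPi E N v) w : GL (Fin N) (w.1.adicCompletion E)) : Matrix (Fin N) (Fin N) (w.1.adicCompletion E)).det = 1}) := by
    rw [Set.image_image]
    exact Set.image_congr fun u _ => inclPlaceAdelic_apply F E c N J v u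
  rw [himg] at hx ⊢
  have h := conj_finAdelicToAdelic_mem_image E c N J _ (fun g s hs => conj_mem_image_inclPlace_det_eq_one E c N J v g hs) a⁻¹ hx
  rwa [inv_inv] at h

/-! ## §3 `toAdelic(SU(J)(F)) ⊆ A_G · G(F)` -/

/-- **Rational points are stabiliser elements**: `toAdelic '' S ⊆ A_G · U(J)(F)` (`= quotientSubgroup`, here with `A_G = 1`) for
every `S ⊆ U(J)(F)`. [cite: BorelJacquet1979, §4.1] -/
theorem toAdelic_image_subset_quotientSubgroup (S : Set (rational F E c N J)) :
    toAdelic F E c N J '' S ⊆ ((adelicGroupData F E c N J).quotientSubgroup : Set (adelicGroupData F E c N J).Adelic) := by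
  rintro _ ⟨γ, -, rfl⟩
  exact Subgroup.mem_sup_right ⟨γ, rfl⟩

/-! ## §4 `S₁ = ι_v(SU(J)(F_v))` fixes `P` (socket spelling of ★ `DiscreteAutomorphicRepConjStableFixed`) -/

/-- **`S₁ = ι_v(SU(J)(F_v))` fixes every vector of `P`** as soon as `SU(J)(F_v)` acts trivially on a non-zero finite component `σ ↪ P.finRep`
(★ `DiscreteAutomorphicRep.toContRep_inclPlaceAdelic_apply_eq_self_of_forall_det_eq_one`, in the `∀ s ∈ S₁` spelling of the Kneser
consumer). [cite: BorelJacquet1979, §4.6] [cite: PlatonovRapinchuk1994, §7.4] -/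
theorem forall_mem_image_inclPlaceAdelic_toContRep_apply_eq_self
    {μ : MeasureTheory.Measure (adelicGroupData F E c N J).automorphicQuotient} [(adelicGroupData F E c N J).IsAutomorphicMeasure μ]
    (P : DiscreteAutomorphicRep (adelicGroupData F E c N J) μ)
    {W : Type} [AddCommGroup W] [Module ℂ W] [Nontrivial W] (σ : Representation ℂ (finAdelic F E c N J) W)
    (ι : σ.IntertwiningMap P.finRep) (hι : Function.Injective ι) (v : HeightOneSpectrum (𝓞 F))
    (hfix : ∀ u : ↥(localPi E c N J v), (∀ w : PlacesOver E v,
      (((u : LocalGLPi E N v) w : GL (Fin N) (w.1.adicCompletion E)) : Matrix (Fin N) (Fin N) (w.1.adicCompletion E)).det = 1) →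
      ∀ x : W, σ (inclPlace F E c N J v u) x = x) :
    ∀ s ∈ inclPlaceAdelic F E c N J v '' {u : ↥(localPi E c N J v) | ∀ w : PlacesOver E v,
      (((u : LocalGLPi E N v) w : GL (Fin N) (w.1.adicCompletion E)) : Matrix (Fin N) (Fin N) (w.1.adicCompletion E)).det = 1},
      ∀ f : ↥P.space.toSubmodule, P.space.toContRep s f = f := by
  rintro _ ⟨u, hu, rfl⟩ f
  exact DiscreteAutomorphicRep.toContRep_inclPlaceAdelic_apply_eq_self_of_forall_det_eq_one E c N J P σ ι hι v hfix u hu f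

/-! ## §5 Rank `2`: the density socket (strong approximation for `SU(antidiag(1,1))`, one finite place free) -/

/-- **`SU(𝔸) ⊆ closure ⟨toAdelic SU(F) ∪ ι_{v₁} SU(F_{v₁})⟩` in socket spelling**: for a subgroup `N₀ ≤ U(J)(𝔸_F)` with carrier
`{s | det s = 1}` (`J ≃ antidiag(1,1)`, `E/F` quadratic Galois, `c ≠ 1`, `v₁` a finite place of `F` with a chosen place `w₁ ∣ v₁` of `E`),
`↑N₀ ⊆ closure ↑⟨toAdelic '' SU(F) ∪ ι_{v₁} '' SU(F_{v₁})⟩` — ★ `mem_topologicalClosure_of_det_eq_one` read through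
`Subgroup.topologicalClosure_coe`. [cite: PlatonovRapinchuk1994, §7.4 Thm. 7.12] [cite: Kneser1966, Hauptsatz] -/
theorem coe_subset_closure_of_coe_eq [Algebra.IsQuadraticExtension F E] [IsGalois F E] (hc : c ≠ 1)
    {J : Matrix (Fin 2) (Fin 2) E} (hJ2 : J = !![0, 1; 1, 0]) {v₁ : HeightOneSpectrum (𝓞 F)} (w₁ : PlacesOver E v₁)
    {N₀ : Subgroup (adelicGroupData F E c 2 J).Adelic}
    (hN₀ : (N₀ : Set (adelicGroupData F E c 2 J).Adelic) = {s : ↥(adelic F E c 2 J) |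
      ((s : GL (Fin 2) (AdeleRing (𝓞 E) E)) : Matrix (Fin 2) (Fin 2) (AdeleRing (𝓞 E) E)).det = 1}) :
    (N₀ : Set (adelicGroupData F E c 2 J).Adelic) ⊆
      closure ((Subgroup.closure (toAdelic F E c 2 J '' {γ : rational F E c 2 J | ((γ : GL (Fin 2) E) : Matrix (Fin 2) (Fin 2) E).det = 1} ∪
        inclPlaceAdelic F E c 2 J v₁ '' {u : ↥(localPi E c 2 J v₁) | ∀ w : PlacesOver E v₁,
          (((u : LocalGLPi E 2 v₁) w : GL (Fin 2) (w.1.adicCompletion E)) : Matrix (Fin 2) (Fin 2) (w.1.adicCompletion E)).det = 1}) :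
          Subgroup (adelicGroupData F E c 2 J).Adelic) : Set (adelicGroupData F E c 2 J).Adelic) := by
  intro s hs
  rw [hN₀] at hs
  rw [← Subgroup.topologicalClosure_coe, SetLike.mem_coe]
  exact mem_topologicalClosure_of_det_eq_one F E c hc hJ2 w₁ s hs

/-- **The CM dress of the density socket** (`F = L⁺`, `E = L`, `c` = complex conjugation, `J = Φ₂` in the H413 literal spelling).
[cite: PlatonovRapinchuk1994, §7.4 Thm. 7.12] [cite: Kneser1966, Hauptsatz] -/
theorem cm_coe_subset_closure_of_coe_eq (L : Type) [Field L] [NumberField L] [IsCMField L]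
    {v₁ : HeightOneSpectrum (𝓞 ↥(maximalRealSubfield L))} (w₁ : PlacesOver L v₁)
    {N₀ : Subgroup (adelicGroupData ↥(maximalRealSubfield L) L (IsCMField.complexConj L) 2
      (Matrix.of fun i j : Fin 2 => if i.val + j.val + 1 = 2 then (1 : L) else 0)).Adelic}
    (hN₀ : (N₀ : Set (adelicGroupData ↥(maximalRealSubfield L) L (IsCMField.complexConj L) 2
      (Matrix.of fun i j : Fin 2 => if i.val + j.val + 1 = 2 then (1 : L) else 0)).Adelic) = {s : ↥(adelic ↥(maximalRealSubfield L) L (IsCMField.complexConj L) 2 (Matrix.of fun i j : Fin 2 => if i.val + j.val + 1 = 2 then (1 : L) else 0)) |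
      ((s : GL (Fin 2) (AdeleRing (𝓞 L) L)) : Matrix (Fin 2) (Fin 2) (AdeleRing (𝓞 L) L)).det = 1}) :
    (N₀ : Set (adelicGroupData ↥(maximalRealSubfield L) L (IsCMField.complexConj L) 2
      (Matrix.of fun i j : Fin 2 => if i.val + j.val + 1 = 2 then (1 : L) else 0)).Adelic) ⊆
      closure ((Subgroup.closure (toAdelic ↥(maximalRealSubfield L) L (IsCMField.complexConj L) 2 (Matrix.of fun i j : Fin 2 => if i.val + j.val + 1 = 2 then (1 : L) else 0) ''
          {γ : rational ↥(maximalRealSubfield L) L (IsCMField.complexConj L) 2 (Matrix.of fun i j : Fin 2 => if i.val + j.val + 1 = 2 then (1 : L) else 0) | ((γ : GL (Fin 2) L) : Matrix (Fin 2) (Fin 2) L).det = 1} ∪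
        inclPlaceAdelic ↥(maximalRealSubfield L) L (IsCMField.complexConj L) 2 (Matrix.of fun i j : Fin 2 => if i.val + j.val + 1 = 2 then (1 : L) else 0) v₁ ''
          {u : ↥(localPi L (IsCMField.complexConj L) 2 (Matrix.of fun i j : Fin 2 => if i.val + j.val + 1 = 2 then (1 : L) else 0) v₁) | ∀ w : PlacesOver L v₁,
            (((u : LocalGLPi L 2 v₁) w : GL (Fin 2) (w.1.adicCompletion L)) : Matrix (Fin 2) (Fin 2) (w.1.adicCompletion L)).det = 1}) :
          Subgroup (adelicGroupData ↥(maximalRealSubfield L) L (IsCMField.complexConj L) 2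
      (Matrix.of fun i j : Fin 2 => if i.val + j.val + 1 = 2 then (1 : L) else 0)).Adelic) :
          Set (adelicGroupData ↥(maximalRealSubfield L) L (IsCMField.complexConj L) 2
      (Matrix.of fun i j : Fin 2 => if i.val + j.val + 1 = 2 then (1 : L) else 0)).Adelic) := by
  haveI : Algebra.IsQuadraticExtension ↥(maximalRealSubfield L) L := IsCMField.isQuadraticExtension L
  exact coe_subset_closure_of_coe_eq ↥(maximalRealSubfield L) L (IsCMField.complexConj L) (IsCMField.complexConj_ne_one L)
    (by ext i j; fin_cases i <;> fin_cases j <;> rfl) w₁ hN₀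

/-! ## §6 Plugged: `SU(J)(𝔸_F)` fixes `P`; `P` is a character twist (rank `2`) -/

/-- **«If `SU(J)(F_{v₁})` acts trivially on a finite component of `P`, then `SU(J)(𝔸_F)` acts trivially on `P`»** (`J ≃ antidiag(1,1)`,
`E/F` quadratic Galois, `c ≠ 1`): ★ `DiscreteAutomorphicRep.toContRep_apply_eq_self_of_subset_closure` (Kneser saturation, normal form)
with `N₀ := ker (adelicDet)` (§1), `D := toAdelic '' SU(J)(F)` (§3), `S₁ := ι_{v₁} SU(J)(F_{v₁})` (§4) and the density (§5) = strong
approximation ★ `mem_topologicalClosure_of_det_eq_one`. [cite: PlatonovRapinchuk1994, §7.4 Thm. 7.12 and Prop. 7.13 (proof)]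
[cite: BorelJacquet1979, §4.6] -/
theorem toContRep_apply_eq_self_of_det_eq_one [Algebra.IsQuadraticExtension F E] [IsGalois F E] (hc : c ≠ 1)
    {J : Matrix (Fin 2) (Fin 2) E} (hJ2 : J = !![0, 1; 1, 0])
    {μ : MeasureTheory.Measure (adelicGroupData F E c 2 J).automorphicQuotient} [(adelicGroupData F E c 2 J).IsAutomorphicMeasure μ]
    (P : DiscreteAutomorphicRep (adelicGroupData F E c 2 J) μ)
    {W : Type} [AddCommGroup W] [Module ℂ W] [Nontrivial W] (σ : Representation ℂ (finAdelic F E c 2 J) W)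
    (ι : σ.IntertwiningMap P.finRep) (hι : Function.Injective ι) {v₁ : HeightOneSpectrum (𝓞 F)} (w₁ : PlacesOver E v₁)
    (hfix : ∀ u : ↥(localPi E c 2 J v₁), (∀ w : PlacesOver E v₁,
      (((u : LocalGLPi E 2 v₁) w : GL (Fin 2) (w.1.adicCompletion E)) : Matrix (Fin 2) (Fin 2) (w.1.adicCompletion E)).det = 1) →
      ∀ x : W, σ (inclPlace F E c 2 J v₁ u) x = x)
    (s : ↥(adelic F E c 2 J)) (hs : ((s : GL (Fin 2) (AdeleRing (𝓞 E) E)) : Matrix (Fin 2) (Fin 2) (AdeleRing (𝓞 E) E)).det = 1)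
    (f : ↥P.space.toSubmodule) : P.space.toContRep s f = f := by
  haveI : LocallyCompactSpace (adelicGroupData F E c 2 J).Adelic := inferInstanceAs (LocallyCompactSpace (adelic F E c 2 J))
  haveI : SecondCountableTopology (adelicGroupData F E c 2 J).Adelic := inferInstanceAs (SecondCountableTopology (adelic F E c 2 J))
  obtain ⟨N₀, hN₀n, hN₀c, hN₀⟩ := exists_subgroup_normal_isClosed_coe_eq_setOf_det_eq_one F E c 2 J
  haveI := hN₀n
  have hn : s ∈ (N₀ : Set (adelicGroupData F E c 2 J).Adelic) := by rw [hN₀]; exact hs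
  exact P.toContRep_apply_eq_self_of_subset_closure μ N₀ hN₀c _ (toAdelic_image_subset_quotientSubgroup F E c 2 J _)
    (coe_subset_closure_of_coe_eq F E c hc hJ2 w₁ hN₀)
    (forall_mem_image_inclPlaceAdelic_toContRep_apply_eq_self F E c 2 J P σ ι hι v₁ hfix) hn f

/-- **«One local `SU` fixing a finite component + strong approximation + weak approximation at `∞` ⇒ `P` is a character twist»**
(`J ≃ antidiag(1,1)`, `E/F` quadratic Galois, `c ≠ 1`): ★ `UnitaryGroup.exists_eq_ofChar_of_subset_closure_of_commutator_mem` with every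
socket plugged (§1 `N₀ := ker (adelicDet)` closed normal with all commutators, §3 `D`, §4 `S₁`, §5 density). [cite: PlatonovRapinchuk1994, §7.3
Prop. 7.8, §7.4 Thm. 7.12] [cite: BorelJacquet1979, §4.6] -/
theorem exists_eq_ofChar_of_forall_det_eq_one_apply_eq_self [Algebra.IsQuadraticExtension F E] [IsGalois F E] (hc : c ≠ 1)
    {J : Matrix (Fin 2) (Fin 2) E} (hJ2 : J = !![0, 1; 1, 0])
    {μ : MeasureTheory.Measure (adelicGroupData F E c 2 J).automorphicQuotient} [(adelicGroupData F E c 2 J).IsAutomorphicMeasure μ]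
    (hWA : DenseRange fun γ : (adelicGroupData F E c 2 J).Rational =>
      archPart F E c 2 J ((adelicGroupData F E c 2 J).toAdelic γ))
    (P : DiscreteAutomorphicRep (adelicGroupData F E c 2 J) μ)
    {W : Type} [AddCommGroup W] [Module ℂ W] [Nontrivial W] (σ : Representation ℂ (finAdelic F E c 2 J) W)
    (ι : σ.IntertwiningMap P.finRep) (hι : Function.Injective ι) {v₁ : HeightOneSpectrum (𝓞 F)} (w₁ : PlacesOver E v₁)
    (hfix : ∀ u : ↥(localPi E c 2 J v₁), (∀ w : PlacesOver E v₁,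
      (((u : LocalGLPi E 2 v₁) w : GL (Fin 2) (w.1.adicCompletion E)) : Matrix (Fin 2) (Fin 2) (w.1.adicCompletion E)).det = 1) →
      ∀ x : W, σ (inclPlace F E c 2 J v₁ u) x = x) :
    ∃ ψ : (adelicGroupData F E c 2 J).AutomorphicCharacter, P = DiscreteAutomorphicRep.ofChar ψ μ := by
  haveI : LocallyCompactSpace (adelicGroupData F E c 2 J).Adelic := inferInstanceAs (LocallyCompactSpace (adelic F E c 2 J))
  haveI : SecondCountableTopology (adelicGroupData F E c 2 J).Adelic := inferInstanceAs (SecondCountableTopology (adelic F E c 2 J))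
  obtain ⟨N₀, hN₀n, hN₀c, hN₀⟩ := exists_subgroup_normal_isClosed_coe_eq_setOf_det_eq_one F E c 2 J
  haveI := hN₀n
  have hcomm : ∀ (b : finAdelic F E c 2 J) (g : (adelicGroupData F E c 2 J).Adelic),
      g⁻¹ * (finAdelicToAdelic F E c 2 J b)⁻¹ * g * finAdelicToAdelic F E c 2 J b ∈ N₀ := fun b g => by
    have h : g⁻¹ * (finAdelicToAdelic F E c 2 J b)⁻¹ * g * finAdelicToAdelic F E c 2 J b ∈
        (N₀ : Set (adelicGroupData F E c 2 J).Adelic) := by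
      rw [hN₀]
      exact det_coe_inv_mul_inv_mul_mul F E c 2 J g (finAdelicToAdelic F E c 2 J b)
    exact h
  exact exists_eq_ofChar_of_subset_closure_of_commutator_mem F E c 2 J μ hWA P N₀ hN₀c _
    (toAdelic_image_subset_quotientSubgroup F E c 2 J _) (coe_subset_closure_of_coe_eq F E c hc hJ2 w₁ hN₀)
    (forall_mem_image_inclPlaceAdelic_toContRep_apply_eq_self F E c 2 J P σ ι hι v₁ hfix) hcomm

end UnitaryGroup

end Literature.NumberTheory.Automorphic

end
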